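import Summits.BirchSwinnertonDyer.BirchSwinnertonDyer.Theorems.KolyvaginRankRigidityAtTwoChebotarevWindowPrimeAtTwo
import Summits.BirchSwinnertonDyer.BirchSwinnertonDyer.Theorems.KolyvaginRankRigidityAtTwoKolyvaginCorankLowerBoundAtTwoConjSign
import Literature.NumberTheory.EllipticCurves.ArtinFormalismQuadraticLocalProofs
import HarnessLib

/-!
# Crux V2♭ₘ `KolyvaginCorankLowerBoundAtTwoMargin` (stmt-BirchSwinnertonDyer-27015 ← 24623), line
# `kolyvagin_depth_split` (lead g7 RESHAPE 3, `windowsTheta_of_swap` p619681): hypothesis `hcheb` —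
# ONE-CLASS ČEBOTAREV AT `2` WITH INDEX RAISING, IN KOLYVAGIN-CLASS CURRENCY, constant `c₁ = 2`
# (helper, PROVED, unconditional; width seat `bsd-line-krr2-p2` g6)

`windowsTheta_of_swap` (lead, `Theorems/KolyvaginRankRigidityAtTwoSwapInduction.lean`) reduces the
registered window supply T5⁺ to four inputs; (S2) = `hcheb`: for a Kolyvagin–Heegner datum of
conductor `n` on V2♭'s habitat and frame, `1 ≤ M ≤ M(n)`, `M ≤ I`, `c₁ ≤ m`, `2^m c_M(n) ≠ 0` ⇒ for
every finite exclusion set a Kolyvagin prime `q` at `2` with `I ≤ M(q)` and a place `v ∋ q` with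
`2^{m - c₁} c_M(n) ∉ ker loc_v`. This file proves it with **`c₁ = 2`**
(`chebotarevOneClassIndexAtTwo_two`), and closes the REGISTERED stub
`stub_chebotarevOneClassIndexAtTwo` of the lead's 27015 skeleton (`∃ c₁`, witnessed by `c₁ := 2`): the eigen-sign of `c_M(n)` is the landed T3 `stub_conjSign`
(for `σ₀ =` the non-trivial automorphism of `K`), and the rest is the seat's order-free habitat
theorem `exists_kolyvaginPrime_notMem_of_heegner` (two-level Čebotarev at `2`, both signs of `Δ_E`).
The binders are V2♭'s habitat and frame followed by `hcheb`'s binders verbatim with `c₁ := 2`; the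
registered stub text (once the lead registers the 27015 skeleton) is expected to be this up to the
placement of `c₁`. HONEST FRAMING: helper (`--supports`); V2♭ₘ / T5⁺ are NOT proved; BSD is not
proved by any of this.

References: [McCallumLMS1991] §3 Cor. 3.2; [Kolyvagin1991MathAnn] §2 (proof of Thm. 2.2);
[WZhang2014] Notations (xii).
-/

set_option autoImplicit false
-- the Theorems namespace of this sub repeats the summit name by design (D-0017 nested layout)
set_option linter.dupNamespace false

noncomputable section

open scoped Classical

namespace Summit.BirchSwinnertonDyer.BirchSwinnertonDyer.Theorems.KolyvaginLowerBoundAtTwo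

open WeierstrassCurve Field NumberField IsDedekindDomain
open Literature.NumberTheory.GaloisRepresentations Literature.NumberTheory.EllipticCurves
  Literature.NumberTheory.EllipticCurves.ModularForms

/-- **(S2) `hcheb` with `c₁ = 2`: one-class Čebotarev at `2` with index raising, Kolyvagin-class
currency.** On V2♭'s habitat and frame: for a datum of conductor `n ∈ Λ`, `1 ≤ M ≤ M(n)`, `M ≤ I`,
`2 ≤ m`, `2^m c_M(n) ≠ 0`, and every finite set `X'`, there is a Kolyvagin prime `q ∉ X'` at `2`
with `I ≤ M(q)` and a place `v ∋ q` of `K` with `2^{m-2} c_M(n) ∉ ker (H¹(K,E[2^M]) → H¹(K_v,E[2^M]))`.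
[cite: McCallumLMS1991, §3 Cor. 3.2] [cite: Kolyvagin1991MathAnn, §2 (proof of Thm. 2.2)]
[cite: WZhang2014, Notations (xii)] -/
theorem chebotarevOneClassIndexAtTwo_two :
    ∀ (W : WeierstrassCurve ℚ) [W.IsElliptic] [W.IsGloballyMinimal], ¬ W.HasCM →
      (Rank1Residual.GoodOrd W 2 ∨ Rank1Residual.Mult W 2) →
      (∀ m : ℕ, W.HasSurjectiveModNGaloisRep (2 ^ m : ℕ)) →
      ∀ (K : Type) [Field K] [NumberField K], IsImaginaryQuadratic K → NumberField.discr K ≠ -3 →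
      NumberField.discr K ≠ -4 → ¬ ((2 : ℤ) ∣ NumberField.discr K) → ∀ [NeZero (W.conductorNorm ℤ)],
      SatisfiesHeegnerHypothesis (W.conductorNorm ℤ) K →
      ∀ (Dt : ModularParametrizationData W (W.conductorNorm ℤ)) (β : ℤ) (ι : K →+* ℂ)
        (n : ℕ) (dat : KolyvaginHeegnerData Dt β ι n) (M m I : ℕ),
      KolyvaginDescent.KolSupp (Zhang2014.IsKolyvaginPrime (W.conductorNorm ℤ) W K 2) n →
      1 ≤ M → (M : ℕ∞) ≤ Zhang2014.levelIndex W 2 n → M ≤ I → 2 ≤ m →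
      ((2 ^ m : ℕ) : ℤ) • dat.kolyvaginClass Nat.prime_two M ≠ 0 →
      ∀ X' : Finset ℕ, ∃ q : ℕ, q ∉ X' ∧ Zhang2014.IsKolyvaginPrime (W.conductorNorm ℤ) W K 2 q ∧
        I ≤ Zhang2014.kolyvaginIndex W 2 q ∧
        ∃ v : HeightOneSpectrum (𝓞 K), ((q : ℕ) : 𝓞 K) ∈ v.asIdeal ∧
          ((2 ^ (m - 2) : ℕ) : ℤ) • dat.kolyvaginClass Nat.prime_two M ∉
            (W.baseChange K).torsionLocalKer (v.adicCompletion K) ((2 ^ M : ℕ) : ℤ) := by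
  intro W _ _ hCM hred hsur K _ _ hK hne3 hne4 h2d _ hHN Dt β ι n dat M m I hn hM1 hMle hMI hm hne X'
  -- the non-trivial automorphism of `K` and the eigen-sign of `c_M(n)` (landed T3)
  obtain ⟨θ, hθ, hc⟩ := exists_sq_eq_discr_not_mem_range K hK.1
  have hσ₀1 : sigmaQ K hK.1 hθ hc ≠ 1 := sigmaQ_ne_one K hK.1 hθ hc
  obtain ⟨ε, hε1, hT3⟩ := stub_conjSign W hCM hred hsur K hK hne3 hne4 h2d hHN Dt β ι
    (sigmaQ K hK.1 hθ hc) hσ₀1 n.primeFactors.card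
  have hκ := hT3 n dat M hn rfl hM1 hMle
  -- the order-free habitat theorem
  obtain ⟨q, hqX, hkoly, hidx, v, hv, hloc⟩ :=
    exists_kolyvaginPrime_notMem_of_heegner W K hsur hK h2d hHN hσ₀1 hM1 hMI
      (dat.kolyvaginClass Nat.prime_two M) hε1 hκ X'
  refine ⟨q, hqX, hkoly, hidx, v, hv, hloc (m - 2) ?_⟩
  rwa [Nat.sub_add_cancel hm]


/-- **(S2) REGISTERED STUB `stub_chebotarevOneClassIndexAtTwo` of the 27015 skeleton** (lead g7,
`kolyvagin_depth_split` RESHAPE 3): `∃ c₁` such that `hcheb` holds — witnessed by `c₁ := 2`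
(`chebotarevOneClassIndexAtTwo_two`). [cite: McCallumLMS1991, §3 Cor. 3.2]
[cite: Kolyvagin1991MathAnn, §2 (proof of Thm. 2.2)] [cite: WZhang2014, Notations (xii)] -/
theorem stub_chebotarevOneClassIndexAtTwo : ∀ (W : WeierstrassCurve ℚ) [W.IsElliptic] [W.IsGloballyMinimal], ¬ W.HasCM → (Rank1Residual.GoodOrd W 2 ∨ Rank1Residual.Mult W 2) → (∀ m : ℕ, W.HasSurjectiveModNGaloisRep (2 ^ m : ℕ)) → ∀ (K : Type) [Field K] [NumberField K], IsImaginaryQuadratic K → NumberField.discr K ≠ -3 → NumberField.discr K ≠ -4 → ¬ ((2 : ℤ) ∣ NumberField.discr K) → ∀ [NeZero (W.conductorNorm ℤ)], SatisfiesHeegnerHypothesis (W.conductorNorm ℤ) K → ∃ c₁ : ℕ, ∀ (Dt : ModularParametrizationData W (W.conductorNorm ℤ)) (β : ℤ) (ι : K →+* ℂ), ∀ (n : ℕ) (dat : KolyvaginHeegnerData Dt β ι n) (M m I : ℕ), KolyvaginDescent.KolSupp (Zhang2014.IsKolyvaginPrime (W.conductorNorm ℤ) W K 2) n → 1 ≤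 M → (M : ℕ∞) ≤ Zhang2014.levelIndex W 2 n → M ≤ I → c₁ ≤ m → ((2 ^ m : ℕ) : ℤ) • dat.kolyvaginClass Nat.prime_two M ≠ 0 → (∀ X' : Finset ℕ, ∃ q : ℕ, q ∉ X' ∧ Zhang2014.IsKolyvaginPrime (W.conductorNorm ℤ) W K 2 q ∧ I ≤ Zhang2014.kolyvaginIndex W 2 q ∧ ∃ v : HeightOneSpectrum (𝓞 K), ((q : ℕ) : 𝓞 K) ∈ v.asIdeal ∧ ((2 ^ (m - c₁) : ℕ) : ℤ) • dat.kolyvaginClass Nat.prime_two M ∉ (W.baseChange K).torsionLocalKer (v.adicCompletion K) ((2 ^ M : ℕ) : ℤ)) := by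
  intro W _ _ hCM hred hsur K _ _ hK hne3 hne4 h2d _ hHN
  exact ⟨2, fun Dt β ι n dat M m I hn hM1 hMle hMI hm hne X' ↦
    chebotarevOneClassIndexAtTwo_two W hCM hred hsur K hK hne3 hne4 h2d hHN Dt β ι n dat M m I hn hM1
      hMle hMI hm hne X'⟩

end Summit.BirchSwinnertonDyer.BirchSwinnertonDyer.Theorems.KolyvaginLowerBoundAtTwo

end
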